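import Summits.Parity.BatemanHorn.Theses.RoughValueTransport

/-!
# Line `sector-width-budget` — skeleton for crux `RoughValueTransport.BalancedSemiprimeLayer`
(item stmt-Parity-9469, route route-Parity-RoughValueTransport; crux-plan of idea card
`Cruxes/BalancedSemiprimeLayer/Ideas/sector-width-budget.md`, triage `TRIAGE-r1-{1,2,3}.md`: pass ×3)

## The crux (by name) and the cut
`BalancedSemiprimeLayer`: for every Bateman–Horn system `f = (f₀,…,f_{k−1})` and every `ε > 0` there
is `δ ∈ (0, 1/4]` with, eventually in `x`,
`Φ_f(x,δ) := #{1 ≤ n ≤ x : every fⱼ(n) > 0 and has no prime factor p < x^{deg fⱼ(1−δ)/2}} ≤ P_f(x) + εx/(log x)^k`.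

**Glue (sorry-free, this file).** `Φ_f(x,δ) ≤ P_f(x) + Σᵢ Eᵢ(x,δ)` where
`Eᵢ(x,δ) := #{1 ≤ n ≤ x : n jointly rough at depth δ (ALL coordinates, as in Φ_f) and fᵢ(n) not prime}`
(`roughCount_le_polyPrimeCount_add_sum`); `Eᵢ` is monotone in `δ` (`coordLayer_mono`), so per-coordinate
statements "∀ ε ∃ δᵢ" combine with `δ := minᵢ δᵢ` and `ε/k` (`BalancedSemiprimeLayer_of`; `k = 0` is the
trivial slice `x ≤ x + 1`). The other coordinates are KEPT ROUGH inside `Eᵢ` — this is exactly the lesson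
of `Disproof.not_coordinatewiseLayerBound` (the naive per-coordinate bound without joint roughness is FALSE
for `(X, X+2)`): each spectator coordinate is one more sieve dimension and supplies one factor `1/log x`.

**Per coordinate, graded by degree** (`coordLayer_thin`):
* `deg fᵢ ≤ 1` — `stub_linearCoordinate` (provable now: `p₁ ≤ √(a x + b)` is an individual modulus,
  `k`-dimensional upper-bound sieve via the PROVED `SieveSequence.fundamental_lemma_uniform_holds`,
  `Σ 1/p₁ ≈ δ`; Disproof.lean "Why it resists", deg-1 bullet; no Bombieri–Vinogradov needed);
* `deg fᵢ = 2` — THE LINE (card `sector-width-budget`, engine of the relaxed divisor family):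
  `stub_pairDictionary` (layer ↪ divisor pairs `(n, m)`, `m ∣ fᵢ(n)`, `x^{1−δ} ≤ m ≤ √fᵢ(n)`, all
  coordinates `x^c`-rough: both balanced primes RELAXED to sieve conditions — legal because the crux is an
  UPPER bound), `stub_classEquidistribution` (**the engine, load-bearing**: a multiplicative density `g`
  approximating the congruence counts `A_d` of the family with POWER saving, uniformly for square-free
  `d ≤ x^γ` prime to a bad modulus `W` — level `x^γ` BEYOND the length `≍ x^δ` of every progression `n ≡ ν (mod m)`; geometric proof =
  Gauss dictionary `(n,m) ↦` form `(m, 2an+b, a fᵢ(n)/m)` of discriminant `D = disc fᵢ` = point of a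
  `Γ`-orbit on `V_D = {B² − 4AC = D}`, the window being `x^δ`-skew cusp boxes / annular `K`-sectors of
  width `≥ x^{−δ}` ("δ is the sector-width budget"), counted `Γ(d)`-uniformly with power saving from the
  uniform spectral gap (Selberg 3/16; Good 1983, Bourgain–Kontorovich–Sarnak 2010, Gorodnik–Nevo /
  Nevo–Sarnak 2010); arithmetic proof = twisted Hooley / DFI level forms — the swappable supplier of the
  panel's merge note), `stub_localDensities` (the densities have dimension `k+1`: Mertens upper bound
  `∏_{p<N}(1 − g(p)) ≤ K'/(log N)^{k+1}`, from `g(p) = (2ρ_{fᵢ}(p) + Σ_{j≠i} ρ_{fⱼ}(p))/p + O(p⁻²)`),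
  `stub_familyMass` (`x/(log x)² ≤ |Fam(x,δ)| ≤ K δ x log x`: the Haar volume of the skew region / Hooley's divisor
  sum in a window — δ IS the main-term factor), `stub_sieveAssembly` (the `(k+1)`-dimensional fundamental
  lemma on the family: engine → densities → mass → `#(rough family) ≤ εx/(log x)^k` for all `δ ≤ δ₀(ε)`);
* `deg fᵢ ≥ 3` — `stub_higherDegreeCoordinate`: **OPEN residual, declared up front** (triage r1-2 §A: no
  line of round 1 touches it; balanced factors `p₁ ~ x^{d(1−δ)/2} > x` exceed every Type-I level:
  `Literature.Barriers.Parity.FordMaynardLowLevel` applies; it is the route's foreseen `LayerHigher`). It is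
  NOT the crux restated: it is the per-coordinate joint layer of one coordinate, summable by the glue.

## Disproof.lean (gen 2) obligations honoured
`balancedSemiprimeLayer_false_without_irreducible` — irreducibility of `fᵢ` is used in `stub_pairDictionary`
(`fᵢ − 1 ≠ 0` has ≤ 2 roots; no repeated factor) and in the engine (non-square discriminant ⇒ genuine form
classes, `ρ_{fᵢ}` well defined); `_false_without_notAssociated` — the spectators `fⱼ`, `j ≠ i`, are DISTINCT
sieve dimensions in `stub_localDensities` (dimension exactly `k+1`; for `(X, X)` it would drop to `k`);
`_false_without_noFixedPrimeDivisor` — `g(p) < 1` for every prime in `stub_classEquidistribution` (a fixed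
prime divisor of `∏ fⱼ` gives `g(p) = 1`, no sieve). Refuted strengthenings NOT engaged: the tolerance stays
`εx/(log x)^k` with `δ = δ(ε, f) → 0` linearly in `ε` (`two_mul_delta_le_of_eventually_layer_X`: `2δ ≤ ε` at
`(X)`; here `δ₀ = ε c^{k+1}/K_f`), never `(log x)^{−(k+1)}`, never a uniform `δ`, never `δ = 1/4` for all `ε`;
`not_coordinatewiseLayerBound` — joint roughness kept in every `Eᵢ` (above). No `Negative/` lemma has landed
for this crux (none to import); negatives index (3 GHL items) not touched.

## Check
`lean check` rc 0; `sorry` exactly in the seven `stub_*`; `BalancedSemiprimeLayer_of : BalancedSemiprimeLayer`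
(conclusion = the route decl BY NAME, no hypotheses) is glue over the stubs with a real proof
(union bound + δ-monotonicity + min over coordinates + `k = 0`).
-/

open scoped BigOperators Classical
open Filter Finset Polynomial

namespace Summit.Parity.BatemanHorn.Cruxes.BalancedSemiprimeLayer.SectorWidthBudget

/-! ## Stubs -/

/-- **Stub 1 — linear coordinates (`deg fᵢ ≤ 1`; provable now, size L).**
For a Bateman–Horn system `f` and a coordinate `fᵢ = a X + b` (degree `0` cannot occur:
`Disproof.natDegree_pos_of_isBatemanHornSystem`), the joint layer
`Eᵢ(x,δ) = #{1 ≤ n ≤ x : all fⱼ(n) > 0 and x^{deg fⱼ(1−δ)/2}-rough, fᵢ(n) not prime}` is `≤ εx/(log x)^k`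
eventually, for some `δ = δ(ε,f) ∈ (0,1/4]`.
Why true / plan: a rough non-prime value `a n + b ≤ a x + b < x^{3(1−δ)/2}` is `1` (≤ 1 value of `n`) or
`p₁ p₂` with `x^{(1−δ)/2} ≤ p₁ ≤ √(a x + b)`; for each such prime `p₁` the `n ≡ −b ā (mod p₁)` form ONE
progression of length `x/p₁ + O(1) ≥ x^{1/2−o(1)}`, sifted by the primes `< x^c` in dimension `k`
(densities `ω_F(p)/p`, `F = ∏ fⱼ`; remainders `≤ ω_F(d)`; level `(x/p₁)^{1/2}`): the PROVED
`Literature.NumberTheory.Sieve.SieveSequence.fundamental_lemma_uniform_holds` gives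
`≪_f (x/p₁)(c log x)^{−k}`, and `Σ_{p₁} 1/p₁ = log(1/(1−δ)) + O(1/log x) ≤ 2δ + o(1)` (Mertens, Mathlib
`Nat.Primes.summable_rpow` / tree Mertens `tendsto_log_mul_prod_one_sub_inv_nat`); take `δ = ε c^k/K_f`.
Dimension input: `IsBatemanHornSystem.hasBatemanHornConst_holds` (Mertens for `ω_F`). Template:
`Disproof.layerConclusion_X` (the system `(X)`), `polyPrimeCount_le_brunSieve_holds`.
Leans on: `IsBatemanHornSystem`, `fundamental_lemma_uniform_holds`, `HasSieveDimension`,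
`hasBatemanHornConst_holds`. -/
theorem stub_linearCoordinate :
    ∀ (k : ℕ) (f : Fin k → ℤ[X]), Literature.NumberTheory.Sieve.IsBatemanHornSystem f →
      ∀ i : Fin k, (f i).natDegree ≤ 1 → ∀ ε : ℝ, 0 < ε → ∃ δ : ℝ, 0 < δ ∧ δ ≤ 1 / 4 ∧
        ∀ᶠ x : ℕ in Filter.atTop,
          (((Finset.Icc 1 x).filter (fun n : ℕ =>
              (∀ j, 0 < (f j).eval (n : ℤ) ∧
                ∀ p ∈ Finset.range ⌈(x : ℝ) ^ (((f j).natDegree : ℝ) * (1 - δ) / 2)⌉₊,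
                  p.Prime → ¬ ((p : ℤ) ∣ (f j).eval (n : ℤ))) ∧
              ¬ ((f i).eval (n : ℤ)).toNat.Prime)).card : ℝ) ≤
            ε * (x : ℝ) / Real.log x ^ k := by
  sorry

/-- **Stub 2 — divisor-pair dictionary with both primes relaxed (`deg fᵢ = 2`; size M).**
For `0 < δ ≤ 1/4`, `0 < c ≤ 1/4` and `x` large: every `n` of the joint layer of a quadratic coordinate
`g = fᵢ`, except the `≤ 2` roots of `g − 1`, has `g(n) = P·Q` composite with least prime factor
`P ≥ x^{1−δ}` (roughness at depth `δ`, exponent `2(1−δ)/2`) and `P² ≤ g(n)`, `P ≤ √(g(n)) ≤ x²`;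
`n ↦ (n, P)` injects the layer into the DIVISOR FAMILY
`Fam(x,δ) = {(n,m) : 1 ≤ n ≤ x, 1 ≤ m ≤ x², all fⱼ(n) > 0, m ∣ g(n), x^{1−δ} ≤ m, m² ≤ g(n)}`
restricted to pairs all of whose coordinate values `fⱼ(n)` are `x^c`-rough (`x^c ≤ x^{3/8} ≤` every
sifting bound of the crux). Both balanced primes are thereby RELAXED to roughness conditions — the
load-bearing legal move of all three round-1 cards (an upper bound needs neither prime honest; triage
r1-1 common finding). This is the card's `LagrangeLayerBound` (brute-forced true by all three triagers,
RHS = 8·LHS at X²+1) with the Gauss/Lagrange matrix replaced by the divisor pair it encodes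
(`n + i = (a+bi)(c+di)`, `m = a²+b²`); the group enters only in the proof of Stub 3.
Plan: `Nat.minFac`, `Nat.minFac_sq_le_self`, `Nat.minFac_prime`; `|g(n)| ≤ A x²` for `n ≤ x`
(coefficient bound); `#{n : g(n) = 1} ≤ 2` by `Polynomial.card_roots'` on `g − 1 ≠ 0` (irreducible of
degree 2); `Finset.card_le_card_of_injOn`. Uses `irreducible` (Disproof `_false_without_irreducible`). -/
theorem stub_pairDictionary :
    ∀ (k : ℕ) (f : Fin k → ℤ[X]), Literature.NumberTheory.Sieve.IsBatemanHornSystem f →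
      ∀ i : Fin k, (f i).natDegree = 2 → ∀ δ c : ℝ, 0 < δ → δ ≤ 1 / 4 → 0 < c → c ≤ 1 / 4 →
        ∀ᶠ x : ℕ in Filter.atTop,
          ((Finset.Icc 1 x).filter (fun n : ℕ =>
              (∀ j, 0 < (f j).eval (n : ℤ) ∧
                ∀ p ∈ Finset.range ⌈(x : ℝ) ^ (((f j).natDegree : ℝ) * (1 - δ) / 2)⌉₊,
                  p.Prime → ¬ ((p : ℤ) ∣ (f j).eval (n : ℤ))) ∧
              ¬ ((f i).eval (n : ℤ)).toNat.Prime)).card ≤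
            2 + ((Finset.Icc 1 x ×ˢ Finset.Icc 1 (x * x)).filter (fun nm : ℕ × ℕ =>
              ((∀ j, 0 < (f j).eval (nm.1 : ℤ)) ∧ ((nm.2 : ℤ) ∣ (f i).eval (nm.1 : ℤ)) ∧
                (x : ℝ) ^ (1 - δ) ≤ (nm.2 : ℝ) ∧ (nm.2 : ℤ) ^ 2 ≤ (f i).eval (nm.1 : ℤ)) ∧
              ∀ j, ∀ p ∈ Finset.range ⌈(x : ℝ) ^ c⌉₊,
                p.Prime → ¬ ((p : ℤ) ∣ (f j).eval (nm.1 : ℤ)))).card := by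
  sorry

/-- **Stub 3 — THE ENGINE: congruence-uniform counting of the divisor family, sieve-ready (`deg fᵢ = 2`;
size XL as a theorem, L over a vendored counting fact; load-bearing stub of the line).**
There are a bad modulus `W ≥ 1` (think `W = 2a·D·∏ Res(fᵢ,fⱼ)`), a multiplicative density `g`
(`0 ≤ g(p) < 1`, `g(p) ≤ B/p`) and exponents `δ₁, γ, σ > 0` such that for every `δ ≤ δ₁`, eventually in `x`,
for ALL square-free `d ≤ x^γ` COPRIME TO `W` simultaneously, `|A_d(x,δ) − g(d)·|Fam(x,δ)|| ≤ K x^{1−σ}`,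
where `A_d = #{(n,m) ∈ Fam(x,δ) : d ∣ m·∏ⱼ fⱼ(n)}` are exactly the congruence sums of the sieve problem
"sift `m·F(n)` over the family" (`p ∣ m·F(n)` ⇔ `p ∣ m` or `p ∣ F(n)`; `m ∣ g(n) ∣ F(n)`). The bad primes are
excluded because the family is a union of SEVERAL `Γ'`-orbits (form classes) whose reductions at primes
dividing `2aD` differ (genus characters): there the joint class distribution is a MIXTURE of product
measures, and `d ↦ A_d/|Fam|` need not be multiplicative; at good primes `SL₂(𝔽_p)` is transitive on
`V_D(𝔽_p)` (Lang), every orbit equidistributes to the SAME local measure `λ_p`, and `g(d) = ∏_{p∣d} λ_p(E_p)`.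
An upper-bound sieve may simply not sift by the primes dividing `W` (Stub 6).
Why this is the crux of the line: every progression `n ≡ ν (mod m)` has only `x/m ≤ x^δ` terms while the
level needed is `x^γ` with `γ ≫ δ` (δ is chosen AFTER γ: `δ₀ = ε c^{k+1}/K`), so individual moduli give
nothing (Disproof "Why it resists", deg-2 bullet; the route's recorded obstruction "roots mod p₁q for PRIME
p₁" is an artefact of keeping `p₁` prime — here `m` runs over ALL integers of the window).
GEOMETRIC PROOF (card `sector-width-budget`, the idea of this line): `(n, m) ↦ (A,B,C) = (m, 2an+b, a·g(n)/m)`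
(`g = aX²+bX+c`) is a bijection onto the integer points of the quadric `V_D : B² − 4AC = D = b² − 4ac`
(non-square since `g` is irreducible) with `B ≡ b (2a)`, `a ∣ C`, in the region
`{x^{1−δ} ≤ A, A² ≤ (B²−D)/(4a), B ≤ 2ax+b}`; `V_D(ℤ)` is a finite union of `Γ'`-orbits (`Γ' = Γ(4a) ≤ SL₂(ℤ)`,
class number × index), and in the orbit `γ ↦ γ·Q₀` the region is a union over dyadic `A` of `x^δ`-skew
boxes — for `D < 0`, via `Q ↦ z_Q = (−B + i√|D|)/(2A) ∈ ℍ`: cusp boxes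
`{Im z ≍ √|D|/A ∈ [x^{−1}, x^{δ−1}], Re z ∈ [√a, κ x·Im z]}` of hyperbolic area `≍ δ x log x` in total
(= the card's annular `K`-sectors `|θ − π/2| ∈ [x^{(1−δ)/2}/T, x/T²]`, `T² ≤ x^{1+δ}`, all widths `≥ x^{−δ}`,
for `X²+1` where `V_{−4}(ℤ) = SL₂(ℤ)·(1,0,1)`); for `D > 0` the stabiliser is the unit group and one counts in
(compact fundamental interval)·(boxes). Equidistribution of `Γ'`-orbit points in such boxes among the
cosets of `Γ'(d)`, with error `x^{O(δ)}·vol^{1−τ}·d^{O(1)}` uniform in `d` (uniform spectral gap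
`λ₁ ≥ 3/16` for congruence subgroups; Good 1983 "Local analysis of Selberg's trace formula" (cusp–point
double cosets: real parts of orbit points at height `Y`), Bourgain–Kontorovich–Sarnak GAFA 2010 (sectors
+ congruences), Gorodnik–Nevo / Nevo–Sarnak doi:10.1007/s11511-010-0057-4 (Lipschitz well-rounded
families, congruence-uniform)) gives the class counts `N_d(r,s) = λ_d(r,s)|Fam| + O(d^{O(1)} x^{1−σ'})`
with PRODUCT local measures `λ_d = ⊗_{p∣d} λ_p` for `(d, W) = 1` (strong approximation
`Γ' ↠ ∏_{p∣d} SL₂(ℤ/p)`), hence `g(d) := λ_d(E_d)` multiplicative and the displayed bound after summing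
`≤ d²` classes (`γ(2+O(1)) < σ'`).
Top dyadic shells (`A → √g(n)`, θ-width → 0; triage r1-2/r1-3 geometry note) are fattened before counting —
legal for the sieve since `A_d` and `|Fam|` are counted in the SAME region. Triage falsifier RUN (r1-1 Part B,
r1-3 j006934): coset counts of the skew family mod `q ≤ 11` are Haar-equidistributed at Poisson level down to
the thinnest sectors, discrepancy decaying like `x^{−0.58}` — no frozen discrepancy.
ARITHMETIC PROOF (swappable supplier, cards `smooth-modulus-twisted-hooley` / `rough-relaxed-divisor-sieve`):
Poisson in `n` + level-`d` linear forms of root Weyl sums `Σ_m ρ_h(dm)` (tree: `RootForms.sum_weylSum_eq_sum_levelForms`,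
PROVED `hooley1963_quadraticRoots_allModuli_logSqSaving_holds`, vendored `dukeFriedlanderIwaniec1995_proposition1/4`).
Nothing affine-sieve / lattice-counting is in the tree yet (`lean search 'NevoSarnak|affineSieve'` = 0;
nearest: `Literature.NumberTheory.Automorphic.hyperbolicLatticeCount`, `sl2BallCount_asymp_of_modular` —
balls for `SL₂(ℤ)`, conditional on the pretrace fact `Iwaniec2002_eq_12_5_modular`): the geometric supplier
needs ONE vendored fact "congruence-uniform counting in `(C, a)`-Lipschitz well-rounded families with error
`C^{O(1)} vol^{1−τ}`" (card tripwire (2): confirm the polynomial dependence on `C = x^δ` in print first).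
Uses `hasNoFixedPrimeDivisor` (`g(p) < 1`) and `irreducible` (non-square `D`). -/
theorem stub_classEquidistribution :
    ∀ (k : ℕ) (f : Fin k → ℤ[X]), Literature.NumberTheory.Sieve.IsBatemanHornSystem f →
      ∀ i : Fin k, (f i).natDegree = 2 →
        ∃ W : ℕ, 0 < W ∧ ∃ g : ArithmeticFunction ℝ, g.IsMultiplicative ∧
          (∃ B : ℝ, ∀ p : ℕ, p.Prime → 0 ≤ g p ∧ g p < 1 ∧ g p ≤ B / p) ∧
          ∃ δ₁ γ σ K : ℝ, 0 < δ₁ ∧ 0 < γ ∧ 0 < σ ∧ ∀ δ : ℝ, 0 < δ → δ ≤ δ₁ →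
            ∀ᶠ x : ℕ in Filter.atTop, ∀ d : ℕ, Squarefree d → Nat.Coprime d W →
              (d : ℝ) ≤ (x : ℝ) ^ γ →
              |(((Finset.Icc 1 x ×ˢ Finset.Icc 1 (x * x)).filter (fun nm : ℕ × ℕ =>
                  ((∀ j, 0 < (f j).eval (nm.1 : ℤ)) ∧ ((nm.2 : ℤ) ∣ (f i).eval (nm.1 : ℤ)) ∧
                    (x : ℝ) ^ (1 - δ) ≤ (nm.2 : ℝ) ∧ (nm.2 : ℤ) ^ 2 ≤ (f i).eval (nm.1 : ℤ)) ∧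
                  (d : ℤ) ∣ (nm.2 : ℤ) * ∏ j, (f j).eval (nm.1 : ℤ))).card : ℝ) -
                g d * (((Finset.Icc 1 x ×ˢ Finset.Icc 1 (x * x)).filter (fun nm : ℕ × ℕ =>
                    (∀ j, 0 < (f j).eval (nm.1 : ℤ)) ∧ ((nm.2 : ℤ) ∣ (f i).eval (nm.1 : ℤ)) ∧
                      (x : ℝ) ^ (1 - δ) ≤ (nm.2 : ℝ) ∧ (nm.2 : ℤ) ^ 2 ≤ (f i).eval (nm.1 : ℤ))).card : ℝ)| ≤
                K * (x : ℝ) ^ (1 - σ) := by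
  sorry

/-- **Stub 4 — the local densities have sieve dimension `k + 1` (Mertens upper bound; size M/L).**
For ANY arithmetic function `g` with `0 ≤ g(p) < 1` that IS the limiting local density of the divisor
family at the primes outside some bad modulus `W` and at one depth `δ ∈ (0,1/4]` —
`A_p(x,δ)/|Fam(x,δ)| → g(p)` as `x → ∞` for every prime `p ∤ W` — one has
`∏_{p < N} (1 − g(p)) ≤ K'/(log N)^{k+1}` for all `N ≥ 2` (`K' = K'(f, i, W, δ)`).
Why true: the factors at `p ∣ W` are `≤ 1`; for `p ∤ W` the hypothesis PINS `g(p)` = the local density of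
the event `p ∣ m·F(n)` on the family; on the divisor-weighted measure `P(p ∣ m) = P(p ∣ g(n)/m) = ρ_g(p)/p + O(p⁻²)`
and `P(p ∣ fⱼ(n)) = ρ_{fⱼ}(p)/p + O(p⁻²)` (`j ≠ i`,
`p ∤ Res(g,fⱼ)`), so `g(p) = (2ρ_g(p) + Σ_{j≠i} ρ_{fⱼ}(p))/p + O(p⁻²)` (the card's "density 2/p per row,
jointly 4/p": the induced measure on `n` is divisor-weighted), and `Σ_{p<N} ρ_h(p) log p/p = log N + O(1)` for
each irreducible `h` (prime ideal theorem; in the tree through `IsBatemanHornSystem.hasBatemanHornConst_holds`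
for the systems `![fⱼ]`, `![fᵢ]` and Mertens `tendsto_log_mul_prod_one_sub_inv_nat`) gives dimension
`2 + (k−1) = k+1`. The spectators MUST be pairwise non-associated and distinct from `fᵢ` for the count `k+1`
(Disproof `_false_without_notAssociated`: for `(X, X)` the dimension drops and the crux is false).
Hooley 1967 (Acta Math. 117, §§5–6; held `paper:galaxy-pdf-699250920`) computes these densities for `n²−D`. -/
theorem stub_localDensities :
    ∀ (k : ℕ) (f : Fin k → ℤ[X]), Literature.NumberTheory.Sieve.IsBatemanHornSystem f →
      ∀ i : Fin k, (f i).natDegree = 2 →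
      ∀ g : ArithmeticFunction ℝ, (∀ p : ℕ, p.Prime → 0 ≤ g p ∧ g p < 1) →
        (∃ W : ℕ, ∃ δ : ℝ, 0 < W ∧ 0 < δ ∧ δ ≤ 1 / 4 ∧ ∀ p : ℕ, p.Prime → Nat.Coprime p W →
          Filter.Tendsto (fun x : ℕ =>
            (((Finset.Icc 1 x ×ˢ Finset.Icc 1 (x * x)).filter (fun nm : ℕ × ℕ =>
              ((∀ j, 0 < (f j).eval (nm.1 : ℤ)) ∧ ((nm.2 : ℤ) ∣ (f i).eval (nm.1 : ℤ)) ∧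
                (x : ℝ) ^ (1 - δ) ≤ (nm.2 : ℝ) ∧ (nm.2 : ℤ) ^ 2 ≤ (f i).eval (nm.1 : ℤ)) ∧
              (p : ℤ) ∣ (nm.2 : ℤ) * ∏ j, (f j).eval (nm.1 : ℤ))).card : ℝ) /
              (((Finset.Icc 1 x ×ˢ Finset.Icc 1 (x * x)).filter (fun nm : ℕ × ℕ =>
                (∀ j, 0 < (f j).eval (nm.1 : ℤ)) ∧ ((nm.2 : ℤ) ∣ (f i).eval (nm.1 : ℤ)) ∧
                  (x : ℝ) ^ (1 - δ) ≤ (nm.2 : ℝ) ∧ (nm.2 : ℤ) ^ 2 ≤ (f i).eval (nm.1 : ℤ))).card : ℝ))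
            Filter.atTop (nhds (g p))) →
        ∃ K' : ℝ, 0 < K' ∧ ∀ N : ℕ, 2 ≤ N →
          ∏ p ∈ Nat.primesBelow N, (1 - g p) ≤ K' / Real.log N ^ (k + 1) := by
  sorry

/-- **Stub 5 — mass of the divisor family (size M): `x/(log x)² ≤ |Fam(x,δ)| ≤ K δ x log x` eventually,
`K = K(f,i)` independent of `δ` (the threshold may depend on `δ`).**  Lower bound (crude, only used to turn
Stub 3's absolute errors into the limits of Stub 4): split primes `m = p ∈ [x^{1−δ}, 2x^{1−δ}]`
(`ρ_g(p) = 2`, density `1/2` of primes: quadratic reciprocity + Dirichlet/PNT in progressions, tree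
`LFunctions`) each carry `≥ x^δ/2 − 1` values `n ≤ x` with `g(n) ≥ p²`, total `≫ x/log x`. Upper bound:
`|Fam| = Σ_{x^{1−δ} ≤ m ≪ x} ρ_g-weighted progression counts
`≤ Σ_m ρ_g(m)(x/m + 1) = x·(c_g δ log x + O(1)) + O(x)` by partial summation from `Σ_{m ≤ M} ρ_g(m) ≪_g M`
(tree: Hooley/Iwaniec root-count mean values, `IwaniecAlmostPrimesRhoMeanValue`, `QuadraticRootCountLogSums`,
`PolynomialCongruencesRootCount`); the `O(x)` is absorbed for `x ≥ e^{O(1/δ)}` (threshold depends on `δ`,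
constant does not). Geometrically: the Haar volume `≍ Σ_{T dyadic} T²·(x/T²)·(log-width) ≍ δ x log x` of the
skew sector family (card, (i)); numerically `|S| = 2 517 536` vs `8·0.32·δ x log x = 2 421 415` at
`x = 3·10⁵, δ = 1/4` (triage r1-3). This is where `δ` becomes the MAIN-TERM factor of the line. -/
theorem stub_familyMass :
    ∀ (k : ℕ) (f : Fin k → ℤ[X]), Literature.NumberTheory.Sieve.IsBatemanHornSystem f →
      ∀ i : Fin k, (f i).natDegree = 2 →
      ∃ K : ℝ, ∀ δ : ℝ, 0 < δ → δ ≤ 1 / 4 → ∀ᶠ x : ℕ in Filter.atTop,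
        (x : ℝ) / Real.log x ^ 2 ≤
            (((Finset.Icc 1 x ×ˢ Finset.Icc 1 (x * x)).filter (fun nm : ℕ × ℕ =>
              (∀ j, 0 < (f j).eval (nm.1 : ℤ)) ∧ ((nm.2 : ℤ) ∣ (f i).eval (nm.1 : ℤ)) ∧
                (x : ℝ) ^ (1 - δ) ≤ (nm.2 : ℝ) ∧ (nm.2 : ℤ) ^ 2 ≤ (f i).eval (nm.1 : ℤ))).card : ℝ) ∧
          (((Finset.Icc 1 x ×ˢ Finset.Icc 1 (x * x)).filter (fun nm : ℕ × ℕ =>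
            (∀ j, 0 < (f j).eval (nm.1 : ℤ)) ∧ ((nm.2 : ℤ) ∣ (f i).eval (nm.1 : ℤ)) ∧
              (x : ℝ) ^ (1 - δ) ≤ (nm.2 : ℝ) ∧ (nm.2 : ℤ) ^ 2 ≤ (f i).eval (nm.1 : ℤ))).card : ℝ) ≤
            K * δ * (x : ℝ) * Real.log x := by
  sorry

/-- **Stub 6 — sieve assembly: the `(k+1)`-dimensional fundamental lemma on the divisor family (size L).**
HYPOTHESES, in this order = the statements of Stub 3 (engine), Stub 4 (local densities), Stub 5 (family mass)
for `(f, i)`, verbatim; CONCLUSION: there is `c ∈ (0,1/4]` such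
that for every `ε > 0` and all `δ ≤ δ₀(ε)`, eventually
`#{(n,m) ∈ Fam(x,δ) : every fⱼ(n) is x^c-rough} ≤ εx/(log x)^k`.
Plan: build `A : SieveSequence` with `a_N = #{(n,m) ∈ Fam(x,δ) : m·F(n) = N}` (`F = ∏ fⱼ > 0` on the family),
STRIPPED of its prime factors dividing `W` (so the sieve never sifts by bad primes — legal for an upper bound:
the displayed rough count is `≤ A.sifted`), `size = |Fam(x,δ)|`, `density = g' := g·1_{(·,W)=1}` with `g` of
Stub 3; then `A.congrSum d = A_d` and `A.remainder d = A_d − g(d)|Fam|` for `(d,W) = 1`, `= 0 − 0` otherwise,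
and `g'(p) ≤ B/p`, `g'(p) < 1` give `HasSieveDimension g' B' K₀` (Mertens). Apply Stub 4 to `g` itself: its
hypothesis is Stub 3 at `δ = min(δ₁,1/4)`, `d = p ≤ x^γ` eventually, divided by
Stub 5's lower bound `|Fam| ≥ x/(log x)²` (`K x^{1−σ}(log x)²/x → 0`) — and use
`V'(z) = ∏_{p<z, p∤W}(1−g(p)) ≤ ∏_{p<z}(1−g(p)) · ∏_{p∣W}(1−g(p))⁻¹ ≤ C_W K'(c log x)^{−(k+1)}`. The PROVED
`Literature.NumberTheory.Sieve.SieveSequence.fundamental_lemma_uniform_holds` with `z = x^c`, `D = x^{γ'}`,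
`γ' = min(γ, σ/2)`, `c = min(γ', 1/4)` (so `s ≥ 1`) yields
`rough count ≤ |Fam|·V(x^c)·(1 + C) + Σ_{d ≤ x^{γ'}} |R_d| ≤ K δ x log x · K'(c log x)^{−(k+1)}(1 + C) + x^{γ'} K x^{1−σ}`,
i.e. `≤ [K K'(1+C) c^{−(k+1)}]·δ·x/(log x)^k + o(x/(log x)^k)`; put `δ₀ = ε c^{k+1}/(2 K K'(1+C))`.
This is the only place the sieve is used; parity-blind (an upper bound of the right ORDER, constant
`≍ c^{−(k+1)}` absorbed by `δ`): `SelbergParityBarrier` / `LinearSieveOptimality` / `WeightedSieveLimit` do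
not bite, `FordMaynardLowLevel` scope caveat "only LOWER bounds are blocked". -/
theorem stub_sieveAssembly :
    ∀ (k : ℕ) (f : Fin k → ℤ[X]), Literature.NumberTheory.Sieve.IsBatemanHornSystem f →
      ∀ i : Fin k, (f i).natDegree = 2 →
      (∃ W : ℕ, 0 < W ∧ ∃ g : ArithmeticFunction ℝ, g.IsMultiplicative ∧
        (∃ B : ℝ, ∀ p : ℕ, p.Prime → 0 ≤ g p ∧ g p < 1 ∧ g p ≤ B / p) ∧
        ∃ δ₁ γ σ K : ℝ, 0 < δ₁ ∧ 0 < γ ∧ 0 < σ ∧ ∀ δ : ℝ, 0 < δ → δ ≤ δ₁ →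
          ∀ᶠ x : ℕ in Filter.atTop, ∀ d : ℕ, Squarefree d → Nat.Coprime d W →
            (d : ℝ) ≤ (x : ℝ) ^ γ →
            |(((Finset.Icc 1 x ×ˢ Finset.Icc 1 (x * x)).filter (fun nm : ℕ × ℕ =>
                ((∀ j, 0 < (f j).eval (nm.1 : ℤ)) ∧ ((nm.2 : ℤ) ∣ (f i).eval (nm.1 : ℤ)) ∧
                  (x : ℝ) ^ (1 - δ) ≤ (nm.2 : ℝ) ∧ (nm.2 : ℤ) ^ 2 ≤ (f i).eval (nm.1 : ℤ)) ∧
                (d : ℤ) ∣ (nm.2 : ℤ) * ∏ j, (f j).eval (nm.1 : ℤ))).card : ℝ) -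
              g d * (((Finset.Icc 1 x ×ˢ Finset.Icc 1 (x * x)).filter (fun nm : ℕ × ℕ =>
                  (∀ j, 0 < (f j).eval (nm.1 : ℤ)) ∧ ((nm.2 : ℤ) ∣ (f i).eval (nm.1 : ℤ)) ∧
                    (x : ℝ) ^ (1 - δ) ≤ (nm.2 : ℝ) ∧ (nm.2 : ℤ) ^ 2 ≤ (f i).eval (nm.1 : ℤ))).card : ℝ)| ≤
              K * (x : ℝ) ^ (1 - σ)) →
      (∀ g : ArithmeticFunction ℝ, (∀ p : ℕ, p.Prime → 0 ≤ g p ∧ g p < 1) →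
        (∃ W : ℕ, ∃ δ : ℝ, 0 < W ∧ 0 < δ ∧ δ ≤ 1 / 4 ∧ ∀ p : ℕ, p.Prime → Nat.Coprime p W →
          Filter.Tendsto (fun x : ℕ =>
            (((Finset.Icc 1 x ×ˢ Finset.Icc 1 (x * x)).filter (fun nm : ℕ × ℕ =>
              ((∀ j, 0 < (f j).eval (nm.1 : ℤ)) ∧ ((nm.2 : ℤ) ∣ (f i).eval (nm.1 : ℤ)) ∧
                (x : ℝ) ^ (1 - δ) ≤ (nm.2 : ℝ) ∧ (nm.2 : ℤ) ^ 2 ≤ (f i).eval (nm.1 : ℤ)) ∧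
              (p : ℤ) ∣ (nm.2 : ℤ) * ∏ j, (f j).eval (nm.1 : ℤ))).card : ℝ) /
              (((Finset.Icc 1 x ×ˢ Finset.Icc 1 (x * x)).filter (fun nm : ℕ × ℕ =>
                (∀ j, 0 < (f j).eval (nm.1 : ℤ)) ∧ ((nm.2 : ℤ) ∣ (f i).eval (nm.1 : ℤ)) ∧
                  (x : ℝ) ^ (1 - δ) ≤ (nm.2 : ℝ) ∧ (nm.2 : ℤ) ^ 2 ≤ (f i).eval (nm.1 : ℤ))).card : ℝ))
            Filter.atTop (nhds (g p))) →
        ∃ K' : ℝ, 0 < K' ∧ ∀ N : ℕ, 2 ≤ N →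
          ∏ p ∈ Nat.primesBelow N, (1 - g p) ≤ K' / Real.log N ^ (k + 1)) →
      (∃ K : ℝ, ∀ δ : ℝ, 0 < δ → δ ≤ 1 / 4 → ∀ᶠ x : ℕ in Filter.atTop,
        (x : ℝ) / Real.log x ^ 2 ≤
            (((Finset.Icc 1 x ×ˢ Finset.Icc 1 (x * x)).filter (fun nm : ℕ × ℕ =>
              (∀ j, 0 < (f j).eval (nm.1 : ℤ)) ∧ ((nm.2 : ℤ) ∣ (f i).eval (nm.1 : ℤ)) ∧
                (x : ℝ) ^ (1 - δ) ≤ (nm.2 : ℝ) ∧ (nm.2 : ℤ) ^ 2 ≤ (f i).eval (nm.1 : ℤ))).card : ℝ) ∧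
          (((Finset.Icc 1 x ×ˢ Finset.Icc 1 (x * x)).filter (fun nm : ℕ × ℕ =>
            (∀ j, 0 < (f j).eval (nm.1 : ℤ)) ∧ ((nm.2 : ℤ) ∣ (f i).eval (nm.1 : ℤ)) ∧
              (x : ℝ) ^ (1 - δ) ≤ (nm.2 : ℝ) ∧ (nm.2 : ℤ) ^ 2 ≤ (f i).eval (nm.1 : ℤ))).card : ℝ) ≤
            K * δ * (x : ℝ) * Real.log x) →
      ∃ c : ℝ, 0 < c ∧ c ≤ 1 / 4 ∧ ∀ ε : ℝ, 0 < ε → ∃ δ₀ : ℝ, 0 < δ₀ ∧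
        ∀ δ : ℝ, 0 < δ → δ ≤ δ₀ → ∀ᶠ x : ℕ in Filter.atTop,
          (((Finset.Icc 1 x ×ˢ Finset.Icc 1 (x * x)).filter (fun nm : ℕ × ℕ =>
            ((∀ j, 0 < (f j).eval (nm.1 : ℤ)) ∧ ((nm.2 : ℤ) ∣ (f i).eval (nm.1 : ℤ)) ∧
              (x : ℝ) ^ (1 - δ) ≤ (nm.2 : ℝ) ∧ (nm.2 : ℤ) ^ 2 ≤ (f i).eval (nm.1 : ℤ)) ∧
            ∀ j, ∀ p ∈ Finset.range ⌈(x : ℝ) ^ c⌉₊,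
              p.Prime → ¬ ((p : ℤ) ∣ (f j).eval (nm.1 : ℤ)))).card : ℝ) ≤
            ε * (x : ℝ) / Real.log x ^ k := by
  sorry

/-- **Stub 7 — coordinates of degree `≥ 3`: OPEN RESIDUAL, declared up front (not claimed by this line).**
The joint layer `Eᵢ(x,δ)` of a coordinate of degree `d ≥ 3` is `≤ εx/(log x)^k` eventually for some
`δ(ε,f)`. Heuristically true (`≈ 2δ·C(f)/∏deg·x/(log x)^k`, numerics j002077: `X³+2` below prediction), but
NO mechanism is known: the balanced factors `p₁ ~ x^{d(1−δ)/2} ≥ x^{9/8}` exceed the number `x` of terms, so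
there is no Type-I/II information at all (`Literature.Barriers.Parity.FordMaynardLowLevel` applies; Disproof
"Why it resists", deg ≥ 3; triage r1-2 §A; card: "no group acts on the torsor of a cubic field"). This is the
route's foreseen `LayerHigher` (TWO-LAYER PLAN), stated per coordinate WITH joint roughness so that it sums
(it is not the crux restricted verbatim). A lead picking this line for the FULL crux holds this stub as the
open problem it is; for systems with `max deg ≤ 2` the other six stubs close the crux (see `layer_of_maxDegree_le_two`). -/
theorem stub_higherDegreeCoordinate :
    ∀ (k : ℕ) (f : Fin k → ℤ[X]), Literature.NumberTheory.Sieve.IsBatemanHornSystem f →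
      ∀ i : Fin k, 3 ≤ (f i).natDegree → ∀ ε : ℝ, 0 < ε → ∃ δ : ℝ, 0 < δ ∧ δ ≤ 1 / 4 ∧
        ∀ᶠ x : ℕ in Filter.atTop,
          (((Finset.Icc 1 x).filter (fun n : ℕ =>
              (∀ j, 0 < (f j).eval (n : ℤ) ∧
                ∀ p ∈ Finset.range ⌈(x : ℝ) ^ (((f j).natDegree : ℝ) * (1 - δ) / 2)⌉₊,
                  p.Prime → ¬ ((p : ℤ) ∣ (f j).eval (n : ℤ))) ∧
              ¬ ((f i).eval (n : ℤ)).toNat.Prime)).card : ℝ) ≤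
            ε * (x : ℝ) / Real.log x ^ k := by
  sorry

/-! ## Glue (sorry-free)

Local ABBREVIATIONS (reducible, ℕ-valued, used only below; every stub above is stated over existing
declarations): `roughCount f δ x = Φ_f(x,δ)` is the crux's left-hand count verbatim and
`coordLayer f i δ x = Eᵢ(x,δ)` the per-coordinate joint layer appearing in Stubs 1, 2, 7. -/

section Glue

variable {k : ℕ}

/-- `Φ_f(x, δ)`, the left-hand count of the crux (its filter predicate verbatim: every `fⱼ(n) > 0` and
free of primes `p < x^{deg fⱼ (1−δ)/2}`). -/
noncomputable abbrev roughCount (f : Fin k → ℤ[X]) (δ : ℝ) (x : ℕ) : ℕ :=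
  ((Finset.Icc 1 x).filter (fun n : ℕ => ∀ j, 0 < (f j).eval (n : ℤ) ∧
    ∀ p ∈ Finset.range ⌈(x : ℝ) ^ (((f j).natDegree : ℝ) * (1 - δ) / 2)⌉₊,
      p.Prime → ¬ ((p : ℤ) ∣ (f j).eval (n : ℤ)))).card

/-- `Eᵢ(x, δ)`: jointly rough `1 ≤ n ≤ x` (ALL coordinates, as in `Φ_f`) whose `i`-th value is not prime. -/
noncomputable abbrev coordLayer (f : Fin k → ℤ[X]) (i : Fin k) (δ : ℝ) (x : ℕ) : ℕ :=
  ((Finset.Icc 1 x).filter (fun n : ℕ =>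
    (∀ j, 0 < (f j).eval (n : ℤ) ∧
      ∀ p ∈ Finset.range ⌈(x : ℝ) ^ (((f j).natDegree : ℝ) * (1 - δ) / 2)⌉₊,
        p.Prime → ¬ ((p : ℤ) ∣ (f j).eval (n : ℤ))) ∧
    ¬ ((f i).eval (n : ℤ)).toNat.Prime)).card

/-- Read-back: the crux is `∀ systems ∀ ε ∃ δ, eventually roughCount ≤ P_f + εx/(log x)^k` (definitional). -/
theorem crux_iff :
    Summit.Parity.BatemanHorn.Theses.RoughValueTransport.BalancedSemiprimeLayer ↔
      ∀ (k : ℕ) (f : Fin k → ℤ[X]), Literature.NumberTheory.Sieve.IsBatemanHornSystem f →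
        ∀ ε : ℝ, 0 < ε → ∃ δ : ℝ, 0 < δ ∧ δ ≤ 1 / 4 ∧ ∀ᶠ x : ℕ in atTop,
          (roughCount f δ x : ℝ) ≤
            (Literature.NumberTheory.Sieve.polyPrimeCount f x : ℝ) + ε * (x : ℝ) / Real.log x ^ k :=
  Iff.rfl

/-- Joint roughness is MONOTONE in `δ`: a smaller `δ` sifts further. -/
theorem jointRough_mono (f : Fin k → ℤ[X]) {δ₁ δ₂ : ℝ} (h : δ₁ ≤ δ₂) {x n : ℕ} (hx : 1 ≤ x)
    (hJ : ∀ j, 0 < (f j).eval (n : ℤ) ∧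
      ∀ p ∈ Finset.range ⌈(x : ℝ) ^ (((f j).natDegree : ℝ) * (1 - δ₁) / 2)⌉₊,
        p.Prime → ¬ ((p : ℤ) ∣ (f j).eval (n : ℤ))) :
    ∀ j, 0 < (f j).eval (n : ℤ) ∧
      ∀ p ∈ Finset.range ⌈(x : ℝ) ^ (((f j).natDegree : ℝ) * (1 - δ₂) / 2)⌉₊,
        p.Prime → ¬ ((p : ℤ) ∣ (f j).eval (n : ℤ)) := by
  intro j
  refine ⟨(hJ j).1, fun p hp hpp => (hJ j).2 p ?_ hpp⟩
  rw [Finset.mem_range] at hp ⊢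
  refine lt_of_lt_of_le hp (Nat.ceil_mono ?_)
  have hx' : (1 : ℝ) ≤ x := by exact_mod_cast hx
  refine Real.rpow_le_rpow_of_exponent_le hx' ?_
  have hd : (0 : ℝ) ≤ (f j).natDegree := Nat.cast_nonneg _
  nlinarith

/-- `Eᵢ(x, δ)` is monotone in `δ`. -/
theorem coordLayer_mono (f : Fin k → ℤ[X]) (i : Fin k) {δ₁ δ₂ : ℝ} (h : δ₁ ≤ δ₂) (x : ℕ) :
    coordLayer f i δ₁ x ≤ coordLayer f i δ₂ x := by
  refine Finset.card_le_card fun n hn => ?_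
  rw [Finset.mem_filter, Finset.mem_Icc] at hn ⊢
  exact ⟨hn.1, jointRough_mono f h (hn.1.1.trans hn.1.2) hn.2.1, hn.2.2⟩

/-- **Union bound with joint roughness kept**: `Φ_f(x,δ) ≤ P_f(x) + Σᵢ Eᵢ(x,δ)` — a jointly rough `n`
either has all values prime (counted by `P_f`, which counts `n` from `0` and primes of any size) or some
`fᵢ(n)` is not prime (counted by `Eᵢ`, the other coordinates staying rough). -/
theorem roughCount_le_polyPrimeCount_add_sum (f : Fin k → ℤ[X]) (δ : ℝ) (x : ℕ) :
    roughCount f δ x ≤ Literature.NumberTheory.Sieve.polyPrimeCount f x + ∑ i, coordLayer f i δ x := by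
  set S : Finset ℕ := (Finset.Icc 1 x).filter (fun n : ℕ => ∀ j, 0 < (f j).eval (n : ℤ) ∧
    ∀ p ∈ Finset.range ⌈(x : ℝ) ^ (((f j).natDegree : ℝ) * (1 - δ) / 2)⌉₊,
      p.Prime → ¬ ((p : ℤ) ∣ (f j).eval (n : ℤ))) with hS
  set Spr : Finset ℕ := S.filter (fun n : ℕ => ∀ i, ((f i).eval (n : ℤ)).toNat.Prime) with hSpr
  set Snp : Fin k → Finset ℕ := fun i => S.filter (fun n : ℕ => ¬ ((f i).eval (n : ℤ)).toNat.Prime)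
    with hSnp
  have hsplit : S ⊆ Spr ∪ Finset.univ.biUnion Snp := by
    intro n hn
    by_cases hall : ∀ i, ((f i).eval (n : ℤ)).toNat.Prime
    · exact Finset.mem_union_left _ (Finset.mem_filter.mpr ⟨hn, hall⟩)
    · push Not at hall
      obtain ⟨i, hi⟩ := hall
      exact Finset.mem_union_right _
        (Finset.mem_biUnion.mpr ⟨i, Finset.mem_univ _, Finset.mem_filter.mpr ⟨hn, hi⟩⟩)
  have h1 : Spr.card ≤ Literature.NumberTheory.Sieve.polyPrimeCount f x := by
    unfold Literature.NumberTheory.Sieve.polyPrimeCount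
    refine Finset.card_le_card fun n hn => ?_
    simp only [hSpr, hS, Finset.mem_filter, Finset.mem_Icc] at hn
    simp only [Finset.mem_filter, Finset.mem_range]
    exact ⟨by omega, fun i => ⟨(hn.1.2 i).1, hn.2 i⟩⟩
  have h2 : ∀ i, (Snp i).card ≤ coordLayer f i δ x := by
    intro i
    refine Finset.card_le_card fun n hn => ?_
    simp only [hSnp, hS, Finset.mem_filter] at hn
    simp only [Finset.mem_filter]
    exact ⟨hn.1.1, hn.1.2, hn.2⟩
  calc roughCount f δ x = S.card := rfl
    _ ≤ (Spr ∪ Finset.univ.biUnion Snp).card := Finset.card_le_card hsplit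
    _ ≤ Spr.card + (Finset.univ.biUnion Snp).card := Finset.card_union_le _ _
    _ ≤ Literature.NumberTheory.Sieve.polyPrimeCount f x + ∑ i, coordLayer f i δ x := by
        exact add_le_add h1 (Finset.card_biUnion_le.trans (Finset.sum_le_sum fun i _ => h2 i))

/-- `ε · x/(log x)^k → ∞` along `ℕ` (`ε > 0`). [ported from `Disproof.tendsto_mul_div_log_pow_atTop`] -/
theorem tendsto_mul_div_log_pow_atTop {ε : ℝ} (hε : 0 < ε) (k : ℕ) :
    Tendsto (fun x : ℕ => ε * x / Real.log x ^ k) atTop atTop := by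
  have h1 : Tendsto (fun x : ℝ => Real.log x ^ k / x) atTop (nhds 0) := by
    simpa using Real.tendsto_pow_log_div_mul_add_atTop 1 0 k one_ne_zero
  have h2 : Tendsto (fun x : ℝ => Real.log x ^ k / x) atTop (nhdsWithin 0 (Set.Ioi 0)) := by
    refine tendsto_nhdsWithin_iff.mpr ⟨h1, ?_⟩
    filter_upwards [eventually_gt_atTop 1] with x hx
    exact div_pos (pow_pos (Real.log_pos hx) k) (by linarith)
  have h3 := (h2.inv_tendsto_nhdsGT_zero).comp tendsto_natCast_atTop_atTop
  have h4 := h3.const_mul_atTop hε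
  refine h4.congr' (Eventually.of_forall fun x => ?_)
  simp only [Function.comp_apply, Pi.inv_apply, inv_div]
  ring

/-- **The quadratic coordinate** (Stubs 2–6): `∀ ε ∃ δ, Eᵢ(x,δ) ≤ εx/(log x)^k` eventually. -/
theorem coordLayer_quadratic (f : Fin k → ℤ[X]) (hf : Literature.NumberTheory.Sieve.IsBatemanHornSystem f)
    (i : Fin k) (hi : (f i).natDegree = 2) {ε : ℝ} (hε : 0 < ε) :
    ∃ δ : ℝ, 0 < δ ∧ δ ≤ 1 / 4 ∧ ∀ᶠ x : ℕ in atTop,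
      (coordLayer f i δ x : ℝ) ≤ ε * (x : ℝ) / Real.log x ^ k := by
  obtain ⟨c, hc0, hc4, H⟩ := stub_sieveAssembly k f hf i hi (stub_classEquidistribution k f hf i hi)
    (stub_localDensities k f hf i hi) (stub_familyMass k f hf i hi)
  obtain ⟨δ₀, hδ₀, Hδ⟩ := H (ε / 2) (half_pos hε)
  have hδpos : 0 < min δ₀ (1 / 4) := lt_min hδ₀ (by norm_num)
  refine ⟨min δ₀ (1 / 4), hδpos, min_le_right _ _, ?_⟩
  filter_upwards [stub_pairDictionary k f hf i hi (min δ₀ (1 / 4)) c hδpos (min_le_right _ _) hc0 hc4,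
    Hδ (min δ₀ (1 / 4)) hδpos (min_le_left _ _),
    (tendsto_mul_div_log_pow_atTop (half_pos hε) k).eventually_ge_atTop 2] with x h1 h2 h3
  have h1' := (Nat.cast_le (α := ℝ)).mpr h1
  push_cast at h1'
  have : (coordLayer f i (min δ₀ (1 / 4)) x : ℝ) ≤ ε / 2 * x / Real.log x ^ k + ε / 2 * x / Real.log x ^ k :=
    by linarith
  calc (coordLayer f i (min δ₀ (1 / 4)) x : ℝ)
      ≤ ε / 2 * x / Real.log x ^ k + ε / 2 * x / Real.log x ^ k := this
    _ = ε * x / Real.log x ^ k := by ring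

/-- **Every coordinate**, by degree: `≤ 1` Stub 1 · `= 2` Stubs 2–6 · `≥ 3` Stub 7 (open). -/
theorem coordLayer_thin (f : Fin k → ℤ[X]) (hf : Literature.NumberTheory.Sieve.IsBatemanHornSystem f)
    (i : Fin k) {ε : ℝ} (hε : 0 < ε) :
    ∃ δ : ℝ, 0 < δ ∧ δ ≤ 1 / 4 ∧ ∀ᶠ x : ℕ in atTop,
      (coordLayer f i δ x : ℝ) ≤ ε * (x : ℝ) / Real.log x ^ k := by
  rcases Nat.lt_or_ge (f i).natDegree 2 with h | h
  · exact stub_linearCoordinate k f hf i (by omega) ε hε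
  · rcases h.eq_or_lt with h2 | h3
    · exact coordLayer_quadratic f hf i h2.symm hε
    · exact stub_higherDegreeCoordinate k f hf i (by omega) ε hε

/-- **The composition — concludes the crux BY NAME.** Per system: `k = 0` is `#[1,x] = x ≤ x + 1 = P_f(x)`;
for `k ≥ 1` take `δᵢ(ε/k)` from `coordLayer_thin` for each coordinate, `δ := minᵢ δᵢ`, and sum
`Φ_f ≤ P_f + Σᵢ Eᵢ(x,δ) ≤ P_f + Σᵢ Eᵢ(x,δᵢ) ≤ P_f + k·(ε/k)·x/(log x)^k` (monotonicity in `δ`). -/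
theorem BalancedSemiprimeLayer_of :
    Summit.Parity.BatemanHorn.Theses.RoughValueTransport.BalancedSemiprimeLayer := by
  rw [crux_iff]
  intro k f hf ε hε
  rcases Nat.eq_zero_or_pos k with hk | hk
  · subst hk
    refine ⟨1 / 4, by norm_num, le_rfl, Eventually.of_forall fun x => ?_⟩
    have h1 : roughCount f (1 / 4) x ≤ x := by
      calc roughCount f (1 / 4) x ≤ (Finset.Icc 1 x).card := Finset.card_filter_le _ _
        _ = x := by simp
    have h2 : Literature.NumberTheory.Sieve.polyPrimeCount f x = x + 1 := by
      unfold Literature.NumberTheory.Sieve.polyPrimeCount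
      rw [Finset.filter_true_of_mem (fun n _ => fun i => i.elim0), Finset.card_range]
    have h1' : (roughCount f (1 / 4) x : ℝ) ≤ x := by exact_mod_cast h1
    have h3 : (0 : ℝ) ≤ ε * x / Real.log x ^ 0 := by positivity
    rw [h2]
    push_cast
    linarith
  · have hk' : (0 : ℝ) < k := by exact_mod_cast hk
    choose δf hδpos hδle hδev using
      fun i : Fin k => coordLayer_thin f hf i (ε := ε / k) (div_pos hε hk')
    obtain ⟨i₀, -, hi₀⟩ := Finset.exists_min_image Finset.univ δf ⟨⟨0, hk⟩, Finset.mem_univ _⟩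
    refine ⟨δf i₀, hδpos i₀, hδle i₀, ?_⟩
    have hall : ∀ᶠ x : ℕ in atTop, ∀ i, (coordLayer f i (δf i) x : ℝ) ≤ ε / k * x / Real.log x ^ k :=
      Filter.eventually_all.mpr hδev
    filter_upwards [hall] with x hx
    have hsum : (∑ i, (coordLayer f i (δf i₀) x : ℝ)) ≤ ∑ _i : Fin k, ε / k * x / Real.log x ^ k := by
      refine Finset.sum_le_sum fun i _ => ?_
      calc (coordLayer f i (δf i₀) x : ℝ) ≤ coordLayer f i (δf i) x := by
            exact_mod_cast coordLayer_mono f i (hi₀ i (Finset.mem_univ i)) x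
        _ ≤ _ := hx i
    rw [Finset.sum_const, Finset.card_univ, Fintype.card_fin, nsmul_eq_mul] at hsum
    have hmain : (roughCount f (δf i₀) x : ℝ) ≤
        Literature.NumberTheory.Sieve.polyPrimeCount f x + ∑ i, (coordLayer f i (δf i₀) x : ℝ) := by
      exact_mod_cast roughCount_le_polyPrimeCount_add_sum f (δf i₀) x
    have hkk : (k : ℝ) * (ε / k * x / Real.log x ^ k) = ε * x / Real.log x ^ k := by
      field_simp
    linarith

/-- **Reach of the line without the open residual**: for systems all of whose coordinates have degree
`≤ 2`, Stubs 1–6 alone give the crux's conclusion (Stub 7 is never invoked). Recorded so that a lead /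
tenure planner can file the degree split `LayerLinear → LayerQuadratic → LayerHigher` with this line
attached to the first two. -/
theorem layer_of_maxDegree_le_two (f : Fin k → ℤ[X])
    (hf : Literature.NumberTheory.Sieve.IsBatemanHornSystem f) (hdeg : ∀ i, (f i).natDegree ≤ 2)
    (i : Fin k) {ε : ℝ} (hε : 0 < ε) :
    ∃ δ : ℝ, 0 < δ ∧ δ ≤ 1 / 4 ∧ ∀ᶠ x : ℕ in atTop,
      (coordLayer f i δ x : ℝ) ≤ ε * (x : ℝ) / Real.log x ^ k := by
  rcases Nat.lt_or_ge (f i).natDegree 2 with h | h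
  · exact stub_linearCoordinate k f hf i (by omega) ε hε
  · exact coordLayer_quadratic f hf i (le_antisymm (hdeg i) h) hε

end Glue

end Summit.Parity.BatemanHorn.Cruxes.BalancedSemiprimeLayer.SectorWidthBudget
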